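import Summits.ValiantsHypothesis.ValiantsHypothesis.Theorems.KPlusLogSqLawTropicalBToeplitzSix
import Summits.ValiantsHypothesis.ValiantsHypothesis.Theorems.KPlusLogSqLawTropicalBToeplitzSeven
import Summits.ValiantsHypothesis.ValiantsHypothesis.Theorems.KPlusLogSqLawTropicalBToeplitzEight
import Summits.ValiantsHypothesis.ValiantsHypothesis.Theorems.KPlusLogSqLawTropicalBToeplitzNine

/-!
# Route `KPlusLogSqLaw`, crux `TropicalB` — Toeplitz sector: the CORNER PIN (monotonicity of Conjecture T's count in the size)

HONEST FRAMING.  Helper toward the registered stubs `stub_tropThin` / `stub_tropFat` of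
`Cruxes/TropicalB/Lines/birth.lean` (crux `Summit.ValiantsHypothesis.ValiantsHypothesis.Theses.KPlusLogSqLaw.TropicalB`,
ledger item `stmt-ValiantsHypothesis-19771`, route `KPlusLogSqLaw`; cell `pub-symmetroid`, seat `val-sym-trop-p3`,
2026-08-26).  Structure of the cell's Conjecture T (linear Toeplitz instances `(ψ, α, P)`, the hypothesis of
`toeplitz_chain_le_of_linearBound`, p429098): the LOWER direction of the frame recursion («O5» of the cell's method memo
CONJT-METHOD-g22 §3.4 F2, there resolved on paper).  Nothing here bounds `Φ_Toep`, `TropicalB`, `KPlusLogSqLaw`,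
`MatrixDescartes` or anything about `VP ≠ VNP`; Conjecture T is OPEN.

THE RESULTS.
* `toeplitz_cornerPin_chain` — **the corner pin.**  Every family `τ₀, …, τ_N` of pairwise distinct admissible UNIQUE maximisers
  of a linear Toeplitz instance `(ψ, α, P)` of size `m` at slopes `θ'_k` is — with the same slopes and the same length — such a
  family of an explicit instance of size `m + 1`: the permutations are the lifts `τ̃ 0 = m`, `τ̃ (b+1) = τ b` (displacements:
  the corner displacement `m`, realised by the single entry `(m, 0)`, and the old ones shifted by `−1`), the instance is the old
  one READ AT `δ + 1` (`ψ̃ δ = ψ (δ+1)`, `α̃ δ = α (δ+1)` off `δ = m`) with a PIN `α̃ m = H` (a height exceeding every weight in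
  play) and `ψ̃ m = 0`, and the admissible set is `δ = m ∨ P (δ+1)`.  A competitor either avoids the corner (and loses `H`) or
  uses it, and then it is the lift of an admissible competitor of size `m`, beaten by hypothesis.
* `toeplitz_linearBound_of_succ`, `toeplitz_linearBound_of_le` — hence any `Φ` bounding the chains of ALL linear instances
  at size `m + 1` (resp. at some size `m' ≥ m`) bounds them at size `m` (the hypothesis shape of
  `toeplitz_chain_le_of_linearBound`): **`Φ_Toep` is non-decreasing in the size.**
* `toeplitz_linearBound_ge_of_six_le` / `…seven_le` / `…eight_le` / `…nine_le` — so the kernel certificates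
  `toeplitz_linearBound_{six,seven,eight,nine}_ge` (18 / 23 / 26 / 28 unique optima at `m = 6 / 7 / 8 / 9`) are floors at
  EVERY larger size: e.g. `28 ≤ Φ` for every `Φ` of the hypothesis shape at any `m ≥ 9` (the located `m = 10` row «26» of the
  cell's kit table is superseded in kernel).

References: folklore (pinning an assignment variable by a dominating cost); `toeplitz_linearBound_nine_ge` etc.
(`…ToeplitzSix/Seven/Eight/Nine`).
-/

set_option linter.dupNamespace false
set_option autoImplicit false

namespace Summit.ValiantsHypothesis.ValiantsHypothesis.Theorems.KPlusLogSqLaw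

open scoped BigOperators
open Finset

section CornerPin

variable {m : ℕ}

/-- In `Fin (m+1)` the displacement `m` is realised only by the entry `(m, 0)`. [folklore] -/
theorem perm_displacement_eq_size_iff (σ : Equiv.Perm (Fin (m + 1))) (b : Fin (m + 1)) :
    ((σ b : Fin (m + 1)) : ℤ) - (b : ℤ) = m ↔ b = 0 ∧ σ b = Fin.last m := by
  constructor
  · intro h
    have h1 := (σ b).isLt
    have hb : (b : ℕ) = 0 := by omega
    have hb' : b = 0 := Fin.ext hb
    refine ⟨hb', Fin.ext ?_⟩
    rw [Fin.val_last]; omega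
  · rintro ⟨rfl, h⟩
    rw [h]; simp

/-- **The corner pin.**  A family of pairwise distinct admissible unique maximisers of a linear Toeplitz instance of size
`m` lifts, with the same slopes, to such a family of the instance of size `m + 1` read at `δ + 1` with the corner
displacement `m` pinned by a dominating intercept `H` (and made admissible).  See the module docstring. [folklore] -/
theorem toeplitz_cornerPin_chain (ψ α : ℤ → ℤ) (P : ℤ → Prop) {N : ℕ} (θ' : Fin (N + 1) → ℤ)
    (τ : Fin (N + 1) → Equiv.Perm (Fin m)) (hinj : Function.Injective τ)
    (hτP : ∀ k b, P ((τ k b : ℤ) - b))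
    (huniq : ∀ k (σ : Equiv.Perm (Fin m)), σ ≠ τ k → (∀ b, P ((σ b : ℤ) - b)) →
      ∑ b, (θ' k * ψ ((σ b : ℤ) - b) + α ((σ b : ℤ) - b)) <
        ∑ b, (θ' k * ψ ((τ k b : ℤ) - b) + α ((τ k b : ℤ) - b))) :
    ∃ (H : ℤ) (τ' : Fin (N + 1) → Equiv.Perm (Fin (m + 1))),
      Function.Injective τ' ∧ (∀ k, τ' k 0 = Fin.last m) ∧ (∀ k (b : Fin m), τ' k b.succ = Fin.castSucc (τ k b)) ∧
      (∀ k b, ((τ' k b : ℤ) - b = m ∨ P ((τ' k b : ℤ) - b + 1))) ∧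
      ∀ k (σ' : Equiv.Perm (Fin (m + 1))), σ' ≠ τ' k → (∀ b, ((σ' b : ℤ) - b = m ∨ P ((σ' b : ℤ) - b + 1))) →
        ∑ b, (θ' k * (if (σ' b : ℤ) - b = m then 0 else ψ ((σ' b : ℤ) - b + 1)) +
            (if (σ' b : ℤ) - b = m then H else α ((σ' b : ℤ) - b + 1))) <
          ∑ b, (θ' k * (if (τ' k b : ℤ) - b = m then 0 else ψ ((τ' k b : ℤ) - b + 1)) +
            (if (τ' k b : ℤ) - b = m then H else α ((τ' k b : ℤ) - b + 1))) := by
  classical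
  -- a common bound `B` for every weight in play, and the pin height `H`
  set B : ℤ := ∑ k : Fin (N + 1), ∑ d ∈ Icc (-(m : ℤ) - 1) (m + 1), |θ' k * ψ d + α d| with hB
  have hB0 : 0 ≤ B := sum_nonneg fun k _ => sum_nonneg fun d _ => abs_nonneg _
  have hBd : ∀ (k : Fin (N + 1)) (d : ℤ), -(m : ℤ) - 1 ≤ d → d ≤ m + 1 → |θ' k * ψ d + α d| ≤ B := by
    intro k d h1 h2
    calc |θ' k * ψ d + α d| ≤ ∑ d' ∈ Icc (-(m : ℤ) - 1) (m + 1), |θ' k * ψ d' + α d'| :=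
          single_le_sum (f := fun d' => |θ' k * ψ d' + α d'|) (fun _ _ => abs_nonneg _)
            (by rw [mem_Icc]; exact ⟨h1, h2⟩)
      _ ≤ B := single_le_sum (f := fun k' => ∑ d' ∈ Icc (-(m : ℤ) - 1) (m + 1), |θ' k' * ψ d' + α d'|)
            (fun _ _ => sum_nonneg fun _ _ => abs_nonneg _) (mem_univ k)
  set H : ℤ := (2 * m + 2) * B + 1 with hH
  -- the lift `σ ↦ σ̃`, `σ̃ 0 = last`, `σ̃ (b+1) = σ b`
  let L : Equiv.Perm (Fin m) → Equiv.Perm (Fin (m + 1)) := fun σ =>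
    ((finSuccEquiv m).trans (Equiv.optionCongr (σ : Fin m ≃ Fin m))).trans finSuccEquivLast.symm
  have hL0 : ∀ σ, L σ 0 = Fin.last m := by
    intro σ
    simp only [L, Equiv.trans_apply, finSuccEquiv_zero, Equiv.optionCongr_apply, Option.map_none,
      finSuccEquivLast_symm_none]
  have hLs : ∀ σ (b : Fin m), L σ b.succ = Fin.castSucc (σ b) := by
    intro σ b
    simp only [L, Equiv.trans_apply, finSuccEquiv_succ, Equiv.optionCongr_apply, Option.map_some,
      finSuccEquivLast_symm_some]
  have hLinj : Function.Injective L := by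
    intro σ σ' h
    ext b
    have h1 : L σ b.succ = L σ' b.succ := by rw [h]
    rw [hLs, hLs] at h1
    exact congrArg Fin.val (Fin.castSucc_injective _ h1)
  -- displacements of a lift
  have hd0 : ∀ σ, ((L σ 0 : Fin (m + 1)) : ℤ) - ((0 : Fin (m + 1)) : ℤ) = m := by
    intro σ; rw [hL0]; simp
  have hds : ∀ σ (b : Fin m), ((L σ b.succ : Fin (m + 1)) : ℤ) - ((b.succ : Fin (m + 1)) : ℤ) = ((σ b : ℤ) - b) - 1 := by
    intro σ b; rw [hLs]; simp [Fin.val_succ]; ring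
  have hds_ne : ∀ σ (b : Fin m), ((L σ b.succ : Fin (m + 1)) : ℤ) - ((b.succ : Fin (m + 1)) : ℤ) ≠ m := by
    intro σ b h
    rw [hds] at h
    have := (σ b).isLt
    omega
  -- the lifted weight is `H` plus the old weight
  have hW : ∀ (θ : ℤ) (σ : Equiv.Perm (Fin m)),
      ∑ b, (θ * (if (L σ b : ℤ) - b = m then 0 else ψ ((L σ b : ℤ) - b + 1)) +
          (if (L σ b : ℤ) - b = m then H else α ((L σ b : ℤ) - b + 1))) =
        H + ∑ b, (θ * ψ ((σ b : ℤ) - b) + α ((σ b : ℤ) - b)) := by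
    intro θ σ
    rw [Fin.sum_univ_succ, hd0]
    simp only [if_true, mul_zero, zero_add]
    congr 1
    refine sum_congr rfl fun b _ => ?_
    rw [if_neg (hds_ne σ b), if_neg (hds_ne σ b), hds]
    simp
  -- every lift of the chain is the lifted chain member
  refine ⟨H, fun k => L (τ k), fun k k' h => hinj (hLinj h), fun k => hL0 _, fun k b => hLs _ b, ?_, ?_⟩
  · -- admissibility
    intro k b
    refine Fin.cases ?_ (fun b => ?_) b
    · left; exact hd0 _
    · right; rw [hds]; simpa using hτP k b
  · -- unique optimality
    intro k σ' hσ' hσ'P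
    rw [hW]
    by_cases h0 : σ' 0 = Fin.last m
    · -- the competitor uses the corner: it is the lift of an admissible competitor of size `m`
      have h1 : ∀ b : Fin m, σ' b.succ ≠ Fin.last m := by
        intro b hb
        have := σ'.injective (hb.trans h0.symm)
        exact Fin.succ_ne_zero _ this
      have h2 : ∀ c : Fin m, σ'.symm c.castSucc ≠ 0 := by
        intro c hc
        have : c.castSucc = Fin.last m := by rw [← h0, ← hc, Equiv.apply_symm_apply]
        exact Fin.castSucc_ne_last _ this
      let σ : Equiv.Perm (Fin m) :=
        ⟨fun b => (σ' b.succ).castPred (h1 b), fun c => (σ'.symm c.castSucc).pred (h2 c),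
          fun b => by simp, fun c => by simp⟩
      have hσ : L σ = σ' := by
        ext j
        refine Fin.cases ?_ (fun b => ?_) j
        · rw [hL0, h0]
        · rw [hLs]
          simp [σ]
      have hne : σ ≠ τ k := fun e => hσ' (by rw [← hσ, e])
      have hP : ∀ b, P ((σ b : ℤ) - b) := by
        intro b
        have h := hσ'P b.succ
        rw [← hσ] at h
        rcases h with h | h
        · exact absurd h (hds_ne σ b)
        · rw [hds] at h; simpa using h
      rw [← hσ, hW]
      have := huniq k σ hne hP
      linarith
    · -- the competitor avoids the corner: it loses the pin height
      have hne : ∀ b, ((σ' b : Fin (m + 1)) : ℤ) - (b : ℤ) ≠ m := by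
        intro b hb
        rw [perm_displacement_eq_size_iff] at hb
        obtain ⟨rfl, hb⟩ := hb
        exact h0 hb
      have hup : ∑ b, (θ' k * (if (σ' b : ℤ) - b = m then 0 else ψ ((σ' b : ℤ) - b + 1)) +
          (if (σ' b : ℤ) - b = m then H else α ((σ' b : ℤ) - b + 1))) ≤ (m + 1) * B := by
        calc ∑ b, (θ' k * (if (σ' b : ℤ) - b = m then 0 else ψ ((σ' b : ℤ) - b + 1)) +
              (if (σ' b : ℤ) - b = m then H else α ((σ' b : ℤ) - b + 1)))
            ≤ ∑ _b : Fin (m + 1), B := by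
              refine sum_le_sum fun b _ => ?_
              rw [if_neg (hne b), if_neg (hne b)]
              have h1 := (σ' b).isLt
              have h2 := b.isLt
              exact (le_abs_self _).trans (hBd k _ (by omega) (by omega))
          _ = (m + 1) * B := by simp [sum_const, card_univ, Fintype.card_fin]
      have hdown : -(m * B) ≤ ∑ b, (θ' k * ψ ((τ k b : ℤ) - b) + α ((τ k b : ℤ) - b)) := by
        calc -(m * B) = ∑ _b : Fin m, -B := by simp [sum_const, card_univ, Fintype.card_fin]
          _ ≤ ∑ b, (θ' k * ψ ((τ k b : ℤ) - b) + α ((τ k b : ℤ) - b)) := by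
              refine sum_le_sum fun b _ => ?_
              have h1 := (τ k b).isLt
              have h2 := b.isLt
              exact (neg_le_neg (hBd k _ (by omega) (by omega))).trans (neg_abs_le _)
      have hm0 : (0 : ℤ) ≤ m := Nat.cast_nonneg m
      nlinarith

/-- **Monotonicity of Conjecture T's count, one step** (`Φ_Toep(m) ≤ Φ_Toep(m+1)`): a bound `Φ` on the chains of pairwise
distinct admissible unique optima of EVERY linear Toeplitz instance of size `m + 1` (the hypothesis shape of
`toeplitz_chain_le_of_linearBound`) bounds those of every instance of size `m` (corner pin). [folklore] -/
theorem toeplitz_linearBound_of_succ (Φ : ℕ)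
    (hΦ : ∀ (ψ α : ℤ → ℤ) (P : ℤ → Prop) (N : ℕ) (θ' : Fin (N + 1) → ℤ) (τ : Fin (N + 1) → Equiv.Perm (Fin (m + 1))),
      StrictMono θ' → Function.Injective τ → (∀ k b, P ((τ k b : ℤ) - (b : ℤ))) →
      (∀ k (σ' : Equiv.Perm (Fin (m + 1))), σ' ≠ τ k → (∀ b, P ((σ' b : ℤ) - (b : ℤ))) →
        ∑ b, (θ' k * ψ ((σ' b : ℤ) - (b : ℤ)) + α ((σ' b : ℤ) - (b : ℤ))) <
          ∑ b, (θ' k * ψ ((τ k b : ℤ) - (b : ℤ)) + α ((τ k b : ℤ) - (b : ℤ)))) →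
      N + 1 ≤ Φ)
    (ψ α : ℤ → ℤ) (P : ℤ → Prop) (N : ℕ) (θ' : Fin (N + 1) → ℤ) (τ : Fin (N + 1) → Equiv.Perm (Fin m))
    (hθ : StrictMono θ') (hinj : Function.Injective τ) (hτP : ∀ k b, P ((τ k b : ℤ) - (b : ℤ)))
    (huniq : ∀ k (σ' : Equiv.Perm (Fin m)), σ' ≠ τ k → (∀ b, P ((σ' b : ℤ) - (b : ℤ))) →
      ∑ b, (θ' k * ψ ((σ' b : ℤ) - (b : ℤ)) + α ((σ' b : ℤ) - (b : ℤ))) <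
        ∑ b, (θ' k * ψ ((τ k b : ℤ) - (b : ℤ)) + α ((τ k b : ℤ) - (b : ℤ)))) :
    N + 1 ≤ Φ := by
  obtain ⟨H, τ', hinj', -, -, hP', huniq'⟩ := toeplitz_cornerPin_chain ψ α P θ' τ hinj hτP huniq
  exact hΦ (fun δ => if δ = m then 0 else ψ (δ + 1)) (fun δ => if δ = m then H else α (δ + 1))
    (fun δ => δ = m ∨ P (δ + 1)) N θ' τ' hθ hinj' hP' huniq'

/-- **Monotonicity of Conjecture T's count** (`m ≤ m' ⇒ Φ_Toep(m) ≤ Φ_Toep(m')`): a chain bound for every linear Toeplitz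
instance of size `m'` is a chain bound for every instance of any size `m ≤ m'`. [folklore] -/
theorem toeplitz_linearBound_of_le {m m' : ℕ} (hmm' : m ≤ m') (Φ : ℕ)
    (hΦ : ∀ (ψ α : ℤ → ℤ) (P : ℤ → Prop) (N : ℕ) (θ' : Fin (N + 1) → ℤ) (τ : Fin (N + 1) → Equiv.Perm (Fin m')),
      StrictMono θ' → Function.Injective τ → (∀ k b, P ((τ k b : ℤ) - (b : ℤ))) →
      (∀ k (σ' : Equiv.Perm (Fin m')), σ' ≠ τ k → (∀ b, P ((σ' b : ℤ) - (b : ℤ))) →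
        ∑ b, (θ' k * ψ ((σ' b : ℤ) - (b : ℤ)) + α ((σ' b : ℤ) - (b : ℤ))) <
          ∑ b, (θ' k * ψ ((τ k b : ℤ) - (b : ℤ)) + α ((τ k b : ℤ) - (b : ℤ)))) →
      N + 1 ≤ Φ)
    (ψ α : ℤ → ℤ) (P : ℤ → Prop) (N : ℕ) (θ' : Fin (N + 1) → ℤ) (τ : Fin (N + 1) → Equiv.Perm (Fin m))
    (hθ : StrictMono θ') (hinj : Function.Injective τ) (hτP : ∀ k b, P ((τ k b : ℤ) - (b : ℤ)))
    (huniq : ∀ k (σ' : Equiv.Perm (Fin m)), σ' ≠ τ k → (∀ b, P ((σ' b : ℤ) - (b : ℤ))) →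
      ∑ b, (θ' k * ψ ((σ' b : ℤ) - (b : ℤ)) + α ((σ' b : ℤ) - (b : ℤ))) <
        ∑ b, (θ' k * ψ ((τ k b : ℤ) - (b : ℤ)) + α ((τ k b : ℤ) - (b : ℤ)))) :
    N + 1 ≤ Φ := by
  induction hmm' generalizing ψ α P N with
  | refl => exact hΦ ψ α P N θ' τ hθ hinj hτP huniq
  | step hle ih =>
    exact ih (fun ψ α P N θ' τ hθ hinj hτP huniq => toeplitz_linearBound_of_succ Φ hΦ ψ α P N θ' τ hθ hinj hτP huniq)
      ψ α P N θ' τ hθ hinj hτP huniq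

/-- **Kernel floor at every size `m ≥ 6`:** `18 ≤ Φ` (certificate `toeplitz_linearBound_six_ge` + monotonicity). [folklore] -/
theorem toeplitz_linearBound_ge_of_six_le (hm : 6 ≤ m) (Φ : ℕ)
    (hΦ : ∀ (ψ α : ℤ → ℤ) (P : ℤ → Prop) (N : ℕ) (θ' : Fin (N + 1) → ℤ) (τ : Fin (N + 1) → Equiv.Perm (Fin m)),
      StrictMono θ' → Function.Injective τ → (∀ k b, P ((τ k b : ℤ) - (b : ℤ))) →
      (∀ k (σ' : Equiv.Perm (Fin m)), σ' ≠ τ k → (∀ b, P ((σ' b : ℤ) - (b : ℤ))) →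
        ∑ b, (θ' k * ψ ((σ' b : ℤ) - (b : ℤ)) + α ((σ' b : ℤ) - (b : ℤ))) <
          ∑ b, (θ' k * ψ ((τ k b : ℤ) - (b : ℤ)) + α ((τ k b : ℤ) - (b : ℤ)))) →
      N + 1 ≤ Φ) :
    18 ≤ Φ :=
  toeplitz_linearBound_six_ge Φ fun ψ α P N θ' τ hθ hinj hτP huniq =>
    toeplitz_linearBound_of_le hm Φ hΦ ψ α P N θ' τ hθ hinj hτP huniq

/-- **Kernel floor at every size `m ≥ 7`:** `23 ≤ Φ` (certificate `toeplitz_linearBound_seven_ge` + monotonicity). [folklore] -/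
theorem toeplitz_linearBound_ge_of_seven_le (hm : 7 ≤ m) (Φ : ℕ)
    (hΦ : ∀ (ψ α : ℤ → ℤ) (P : ℤ → Prop) (N : ℕ) (θ' : Fin (N + 1) → ℤ) (τ : Fin (N + 1) → Equiv.Perm (Fin m)),
      StrictMono θ' → Function.Injective τ → (∀ k b, P ((τ k b : ℤ) - (b : ℤ))) →
      (∀ k (σ' : Equiv.Perm (Fin m)), σ' ≠ τ k → (∀ b, P ((σ' b : ℤ) - (b : ℤ))) →
        ∑ b, (θ' k * ψ ((σ' b : ℤ) - (b : ℤ)) + α ((σ' b : ℤ) - (b : ℤ))) <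
          ∑ b, (θ' k * ψ ((τ k b : ℤ) - (b : ℤ)) + α ((τ k b : ℤ) - (b : ℤ)))) →
      N + 1 ≤ Φ) :
    23 ≤ Φ :=
  toeplitz_linearBound_seven_ge Φ fun ψ α P N θ' τ hθ hinj hτP huniq =>
    toeplitz_linearBound_of_le hm Φ hΦ ψ α P N θ' τ hθ hinj hτP huniq

/-- **Kernel floor at every size `m ≥ 8`:** `26 ≤ Φ` (certificate `toeplitz_linearBound_eight_ge` + monotonicity). [folklore] -/
theorem toeplitz_linearBound_ge_of_eight_le (hm : 8 ≤ m) (Φ : ℕ)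
    (hΦ : ∀ (ψ α : ℤ → ℤ) (P : ℤ → Prop) (N : ℕ) (θ' : Fin (N + 1) → ℤ) (τ : Fin (N + 1) → Equiv.Perm (Fin m)),
      StrictMono θ' → Function.Injective τ → (∀ k b, P ((τ k b : ℤ) - (b : ℤ))) →
      (∀ k (σ' : Equiv.Perm (Fin m)), σ' ≠ τ k → (∀ b, P ((σ' b : ℤ) - (b : ℤ))) →
        ∑ b, (θ' k * ψ ((σ' b : ℤ) - (b : ℤ)) + α ((σ' b : ℤ) - (b : ℤ))) <
          ∑ b, (θ' k * ψ ((τ k b : ℤ) - (b : ℤ)) + α ((τ k b : ℤ) - (b : ℤ)))) →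
      N + 1 ≤ Φ) :
    26 ≤ Φ :=
  toeplitz_linearBound_eight_ge Φ fun ψ α P N θ' τ hθ hinj hτP huniq =>
    toeplitz_linearBound_of_le hm Φ hΦ ψ α P N θ' τ hθ hinj hτP huniq

/-- **Kernel floor at every size `m ≥ 9`:** `28 ≤ Φ` (certificate `toeplitz_linearBound_nine_ge` + monotonicity); in
particular the located «26» of the cell's kit table at `m = 10` is superseded: `Φ_Toep(10) ≥ 28`. [folklore] -/
theorem toeplitz_linearBound_ge_of_nine_le (hm : 9 ≤ m) (Φ : ℕ)
    (hΦ : ∀ (ψ α : ℤ → ℤ) (P : ℤ → Prop) (N : ℕ) (θ' : Fin (N + 1) → ℤ) (τ : Fin (N + 1) → Equiv.Perm (Fin m)),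
      StrictMono θ' → Function.Injective τ → (∀ k b, P ((τ k b : ℤ) - (b : ℤ))) →
      (∀ k (σ' : Equiv.Perm (Fin m)), σ' ≠ τ k → (∀ b, P ((σ' b : ℤ) - (b : ℤ))) →
        ∑ b, (θ' k * ψ ((σ' b : ℤ) - (b : ℤ)) + α ((σ' b : ℤ) - (b : ℤ))) <
          ∑ b, (θ' k * ψ ((τ k b : ℤ) - (b : ℤ)) + α ((τ k b : ℤ) - (b : ℤ)))) →
      N + 1 ≤ Φ) :
    28 ≤ Φ :=
  toeplitz_linearBound_nine_ge Φ fun ψ α P N θ' τ hθ hinj hτP huniq =>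
    toeplitz_linearBound_of_le hm Φ hΦ ψ α P N θ' τ hθ hinj hτP huniq

end CornerPin

end Summit.ValiantsHypothesis.ValiantsHypothesis.Theorems.KPlusLogSqLaw
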